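import Summits.CriticalPhenomena.PercolationContinuityZ3.Theorems.PercNearOneGluingNoHeavyQuantGluedWindowNoTopGiant
import Summits.CriticalPhenomena.PercolationContinuityZ3.Theorems.PercNearOneGluingNoHeavyQuantGluedWindowDiagPoolMinus
import HarnessLib

/-!
# QUANT lane R8, T-DEC: LEMMA W's pair condition — the two-row h-mid regime with the TOP COPY UNREACHABLE and `h + r` a GIANT, the middle copy light
# for `h` and LIGHTER for `h` than the pair at `T₀` (the complement of `…QuantGluedWindowNoTopGiant`'s side condition), and the ASSEMBLY of the
# giant case (arm-1 gen 62, architect)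

builds on p205010 (kernel theorem, internal audit signed; external expert review pending)

Support file (`--supports stmt-CriticalPhenomena-4575`), QUANT lane seat prim-quant-arm-1 (gen 62, architect); memo
`run/shared/lean/prim/quant/prim-quant-arm-1-g62/ARCH-G62.md` §1–§4.  Theorems only; standard axioms, no sorries, no definitions.

THE CELL.  As `…QuantGluedWindowNoTopGiant` (p642893): `2l+r+k ≤ T`, `y(h−l) ≤ T−2l`, `T < l+r+h`, `j < h+r` (pool = `{h+r, h+r+k}`, capacity `γ(t₁+t₂)`),
now with `(T−2l−2r)(h−l) ≤ (T₀−2l)(h−l−r)`, i.e. `ρ_h ≤ ρ₀`: the middle copy ships into the pool at the exact light power of `(l+r, h)` and needs LESS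
than its proportional share; the inequality is `diag_poolMinus` (`…QuantGluedWindowDiagPoolMinus`, 82-term certificate kit j310941) from the band fact
`t₀ν + t₁(ν−ε) ≤ ρ₀`.  **`gluedPullback_windowPair_twoRow_noTop_giantG_minus`**; with p642893: **`gluedPullback_windowPair_twoRow_noTop_giant`** — the
pair condition for EVERY configuration of the cell with `j < h + r`, no side condition, no `GluedLemmaW`.

HONEST STATUS.  `GluedLemmaW` (flow form), `GluedDominatedMass`, the band, `SiblingStep`, `FarTreeRow` OPEN; RATE class (log\*) / honest sentence of
`run/shared/lean/prim/quant/README.md` unchanged.  [this work].  Nothing here is cited as a published result.  The gluing rows served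
[cite: KozmaNitzan2024, Conjecture 3 (p. 15)]; product measure [cite: Grimmett1999, §1.3 p. 10].
-/

set_option maxHeartbeats 4000000

noncomputable section

namespace Summit.CriticalPhenomena.PercolationContinuityZ3.Theorems
namespace Quant
namespace LawDec

/-- **TWO-ROW REGIME, h MID, TOP COPY UNREACHABLE, `h + r` A GIANT, MIDDLE COPY LIGHTER FOR `h` THAN THE PAIR AT `T₀`**: `2l + r + k ≤ T`,
`y(h−l) ≤ T−2l`, `T < l + r + h`, `j < h + r`, `(T−2l−2r)(h−l) ≤ (T₀−2l)(h−l−r)` ⟹ `(1−γ)Ψ(l) + γΨ(h) ≤ 0` for every price system and every cheap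
`c ≥ h`. [this work] -/
theorem gluedPullback_windowPair_twoRow_noTop_giantG_minus (x a q g S : ℝ) (B r k j l h c ls : ℕ) (α p : ℕ → ℝ)
    (hx0 : 0 < x) (hx1 : x < 1) (ha0 : 0 < a) (ha1 : a ≤ 1) (hq0 : 0 < q) (hq1 : q < 1) (hg0 : 0 ≤ g) (hg1 : g ≤ 1) (hr : 1 ≤ r)
    (hxqg : x ≤ q * g)
    (hlh : l < h) (hhB : h ≤ B) (hhj : h ≤ j) (hwin : j < h + r + k) (hlow : 2 * (l : ℝ) < a * S) (hcomp : a * S < (l : ℝ) + h)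
    (hlight : pairGate (a * x) (a * S) l h < a * x)
    (hL2j : l + r + k ≤ j) (hL2mid : a * (S + q * ((r : ℝ) + k * g)) ≤ 2 * ((l : ℝ) + r + k))
    (hL1low : 2 * ((l : ℝ) + r) < a * (S + q * ((r : ℝ) + k * g))) (hhmid : a * (S + q * ((r : ℝ) + k * g)) ≤ 2 * (h : ℝ))
    (hincl : 2 * (l : ℝ) + r + k ≤ a * (S + q * ((r : ℝ) + k * g)))
    (hheavyT : (a * x) * ((h : ℝ) - l) ≤ a * (S + q * ((r : ℝ) + k * g)) - 2 * (l : ℝ))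
    (hcompat1 : a * (S + q * ((r : ℝ) + k * g)) < (l : ℝ) + r + h) (hjr : j < h + r)
    (hminus : (a * (S + q * ((r : ℝ) + k * g)) - 2 * ((l : ℝ) + r)) * ((h : ℝ) - l) ≤ (a * S - 2 * (l : ℝ)) * ((h : ℝ) - l - r))
    (hhc : h ≤ c) (hcB : c ≤ B) (hcj : c ≤ j)
    (hp : ∀ h, 0 ≤ p h)
    (hαp : ∀ l' h', l' ≤ j → 2 * (l' : ℝ) < a * (S + q * ((r : ℝ) + k * g)) → h' ≤ B + (r + k) →
      (j + 1 ≤ h' ∨ a * (S + q * ((r : ℝ) + k * g)) < (l' : ℝ) + h') →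
      α l' ≤ usage (a * x) (a * (S + q * ((r : ℝ) + k * g))) j l' h' * p h')
    (hcheap : -(gluedPullback (a * (S + q * ((r : ℝ) + k * g))) q g j r k α p c) * (a * x)
      < (1 - a * x) * gluedPullback (a * (S + q * ((r : ℝ) + k * g))) q g j r k α p ls) :
    (1 - pairGate (a * x) (a * S) l h) * gluedPullback (a * (S + q * ((r : ℝ) + k * g))) q g j r k α p l
      + pairGate (a * x) (a * S) l h * gluedPullback (a * (S + q * ((r : ℝ) + k * g))) q g j r k α p h ≤ 0 := by
  obtain ⟨y, hy⟩ : ∃ y : ℝ, y = a * x := ⟨_, rfl⟩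
  obtain ⟨T, hT⟩ : ∃ T : ℝ, T = a * (S + q * ((r : ℝ) + k * g)) := ⟨_, rfl⟩
  obtain ⟨T₀, hT₀⟩ : ∃ T₀ : ℝ, T₀ = a * S := ⟨_, rfl⟩
  have hy0 : 0 < y := by rw [hy]; exact mul_pos ha0 hx0
  have hyx : y ≤ x := by rw [hy]; nlinarith
  have hy1 : y < 1 := by linarith
  have h1y : 0 < 1 - y := by linarith
  obtain ⟨t1, ht1⟩ : ∃ t1 : ℝ, t1 = q * (1 - g) := ⟨_, rfl⟩
  obtain ⟨t2, ht2⟩ : ∃ t2 : ℝ, t2 = q * g := ⟨_, rfl⟩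
  have ht1p : 0 ≤ t1 := by rw [ht1]; exact mul_nonneg hq0.le (by linarith)
  have ht2p : 0 ≤ t2 := by rw [ht2]; exact mul_nonneg hq0.le hg0
  have et0 : 1 - t1 - t2 = 1 - q := by rw [ht1, ht2]; ring
  have ht0p : 0 ≤ 1 - t1 - t2 := by rw [et0]; linarith
  have hyt2 : y ≤ t2 := by rw [ht2]; linarith
  have hr1 : (1:ℝ) ≤ r := by exact_mod_cast hr
  have hr0 : (0:ℝ) ≤ r := by linarith
  have hk0 : (0:ℝ) ≤ k := Nat.cast_nonneg k
  have hlh' : (l : ℝ) < h := by exact_mod_cast hlh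
  -- geometry
  obtain ⟨d, hd⟩ : ∃ d : ℝ, d = (h : ℝ) - l := ⟨_, rfl⟩
  have hd0 : 0 < d := by rw [hd]; linarith
  obtain ⟨N, hN⟩ : ∃ N : ℝ, N = T - 2 * (l : ℝ) := ⟨_, rfl⟩
  have hA : T - T₀ = a * (q * ((r : ℝ) + k * g)) := by rw [hT, hT₀]; ring
  have em : q * (1 - g) * (r : ℝ) + q * g * ((r : ℝ) + k) = q * ((r : ℝ) + k * g) := by ring
  have hAm : T - T₀ ≤ t1 * r + t2 * ((r : ℝ) + k) := by
    rw [hA, ht1, ht2]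
    have h1 : a * (q * ((r : ℝ) + k * g)) ≤ 1 * (q * ((r : ℝ) + k * g)) :=
      mul_le_mul_of_nonneg_right ha1 (by positivity)
    linarith [h1, em]
  have hNK : (r : ℝ) + k ≤ N := by rw [hN, hT]; linarith
  have hNyd : y * d ≤ N := by rw [hN, hd, hT, hy]; exact hheavyT
  have hNdr : N < d + r := by rw [hN, hd, hT]; linarith [hcompat1]
  have h2rN : 2 * (r : ℝ) < N := by rw [hN, hT]; linarith
  have hN2d : N ≤ 2 * d := by rw [hN, hd, hT]; linarith
  have hN0 : 0 < N := by linarith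
  have hAN : T - T₀ ≤ t1 * r + t2 * N := by nlinarith [hAm, mul_le_mul_of_nonneg_left hNK ht2p]
  have hdr : (r : ℝ) < d := by linarith
  -- the light gate of the first factor
  obtain ⟨ρ₀, hρ₀⟩ : ∃ ρ₀ : ℝ, ρ₀ = (T₀ - 2 * (l : ℝ)) / ((h : ℝ) - l) := ⟨_, rfl⟩
  have hρ₀y : ρ₀ < y := by
    have : (T₀ - 2 * (l : ℝ)) / ((h : ℝ) - l) ≤ pairGate y T₀ l h := le_max_left _ _
    rw [hρ₀]; rw [hy, hT₀] at this ⊢; linarith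
  obtain ⟨γ, hγ⟩ : ∃ γ : ℝ, γ = y ^ 2 + (1 - y) * ρ₀ := ⟨_, rfl⟩
  have hγ' : pairGate (a * x) (a * S) l h = γ := by
    rw [hγ, hρ₀, hT₀, hy]; exact pairGate_eq_light (a * x) (a * S) l h (mul_pos ha0 hx0).le (by rw [← hy, ← hT₀, ← hρ₀]; exact hρ₀y.le)
  have eρ₀ : ρ₀ = (N - (T - T₀)) / d := by rw [hρ₀, hN, hd]; congr 1; ring
  have eρ₀d : ρ₀ * d = N - (T - T₀) := by rw [eρ₀, div_mul_cancel₀ _ hd0.ne']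
  have hρ₀0 : 0 < ρ₀ := by rw [hρ₀]; exact div_pos (by rw [hT₀]; linarith) (by linarith)
  have hγ0 : 0 < γ := by rw [hγ]; positivity
  have hγy : γ < y := by rw [hγ]; nlinarith [mul_lt_mul_of_pos_left hρ₀y h1y]
  have h1γ : 0 < 1 - γ := by linarith
  have hlowl : 2 * (l : ℝ) < T := by linarith
  have eLr : ((l + r : ℕ) : ℝ) = (l : ℝ) + r := by push_cast; ring
  have hlowlr : 2 * ((l + r : ℕ) : ℝ) < T := by rw [eLr]; linarith
  have hcomp1 : T < ((l + r : ℕ) : ℝ) + h := by rw [eLr]; rw [hT]; exact hcompat1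
  -- box coordinates: ν = N/d, ρ_h = (N−2r)/(d−r)
  obtain ⟨nu, hnu⟩ : ∃ nu : ℝ, nu = N / d := ⟨_, rfl⟩
  obtain ⟨rh, hrh⟩ : ∃ rh : ℝ, rh = (N - 2 * (r : ℝ)) / (d - r) := ⟨_, rfl⟩
  have hnuy : y ≤ nu := by rw [hnu, le_div_iff₀ hd0]; exact hNyd
  have hn0 : 0 < nu := lt_of_lt_of_le hy0 hnuy
  have hnu2 : nu ≤ 2 := by rw [hnu, div_le_iff₀ hd0]; linarith
  have hdr0 : 0 < d - r := by linarith
  have hrh0 : 0 < rh := by rw [hrh]; exact div_pos (by linarith) hdr0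
  have erh : (T - 2 * ((l + r : ℕ) : ℝ)) / ((h : ℝ) - ((l + r : ℕ) : ℝ)) = rh := by
    rw [hrh, hN, hd, eLr]; congr 1 <;> ring
  have hγn : γ / nu ≤ 1 := by rw [div_le_one hn0]; linarith
  -- pool power and row l into h
  obtain ⟨pu, hpu⟩ : ∃ pu : ℝ, pu = (1 - y) / y := ⟨_, rfl⟩
  have hpu0 : 0 < pu := by rw [hpu]; exact div_pos h1y hy0
  have vP : pu * (y / (1 - y)) ≤ 1 := by rw [hpu, div_mul_div_comm, mul_comm (1 - y) y, div_self (mul_ne_zero hy0.ne' h1y.ne')]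
  have epu : ∀ z : ℝ, z / pu = z * (y / (1 - y)) := fun z => by rw [hpu, div_div_eq_mul_div, mul_div_assoc]
  obtain ⟨ph, hph0, vH, hcH, hL0, hL0'⟩ : ∃ ph : ℝ, 0 ≤ ph ∧ ph * usage y T j l h ≤ 1 ∧ (ph = 0 ∨ T < (l : ℝ) + h) ∧
      0 ≤ (1 - γ) * (1 - t1 - t2) - γ * (1 - t1 - t2) * ph ∧
      (1 - γ) * (1 - t1 - t2) - γ * (1 - t1 - t2) * ph ≤ (1 - t1 - t2) * (1 - γ / nu) := by
    by_cases hNd : N < d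
    · have hcompa : T < (l : ℝ) + h := by rw [hN, hd] at hNd; linarith
      have eph : ((l : ℝ) + h - T) / (T - 2 * (l : ℝ)) = (1 - nu) / nu := by
        rw [hnu, show (l : ℝ) + h - T = d - N by rw [hd, hN]; ring, ← hN, one_sub_div hd0.ne', div_div_div_cancel_right₀ hd0.ne']
      have e2 : (1 - γ) * (1 - t1 - t2) - γ * (1 - t1 - t2) * ((1 - nu) / nu) = (1 - t1 - t2) * (1 - γ / nu) := by field_simp; ring
      refine ⟨((l : ℝ) + h - T) / (T - 2 * (l : ℝ)), div_nonneg (by linarith) (by linarith), ?_, Or.inr hcompa, ?_, ?_⟩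
      · have e := GluedWindow.apow_heavy_valid y T 1 j l h hy0 hy1 hhj hlowl hcompa (by rw [← hN, ← hd]; exact hNyd)
        rw [one_mul] at e; exact e.le
      · rw [eph, e2]; exact mul_nonneg ht0p (by linarith)
      · rw [eph, e2]
    · refine ⟨0, le_rfl, by rw [zero_mul]; exact zero_le_one, Or.inl rfl, ?_, ?_⟩
      · rw [mul_zero, sub_zero]; exact mul_nonneg h1γ.le ht0p
      · have hn1 : 1 ≤ nu := by rw [hnu, le_div_iff₀ hd0]; linarith
        have : γ / nu ≤ γ := by rw [div_le_iff₀ hn0]; exact le_mul_of_one_le_right hγ0.le hn1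
        rw [mul_zero, sub_zero, mul_comm]
        exact mul_le_mul_of_nonneg_left (by linarith) ht0p
  -- the band fact (c12) in box coordinates, ε = r/d, and the defining relation of ρ_h
  obtain ⟨ee, hee⟩ : ∃ ee : ℝ, ee = (r : ℝ) / d := ⟨_, rfl⟩
  have eN : nu * d = N := by rw [hnu, div_mul_cancel₀ _ hd0.ne']
  have er : ee * d = r := by rw [hee, div_mul_cancel₀ _ hd0.ne']
  have hc12 : (1 - t1 - t2) * nu + t1 * (nu - ee) ≤ ρ₀ := by
    have h1 : ((1 - t1 - t2) * nu + t1 * (nu - ee)) * d ≤ ρ₀ * d := by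
      have e : ((1 - t1 - t2) * nu + t1 * (nu - ee)) * d = (1 - t1 - t2) * (nu * d) + t1 * (nu * d - ee * d) := by ring
      rw [e, eN, er, eρ₀d]; linarith [hAN]
    exact le_of_mul_le_mul_right h1 hd0
  have hrel : rh * (1 - ee) = nu - 2 * ee := by
    have h1 : (rh * (1 - ee)) * d = (nu - 2 * ee) * d := by
      have e1 : (rh * (1 - ee)) * d = rh * (d - ee * d) := by ring
      have e2 : (nu - 2 * ee) * d = nu * d - 2 * (ee * d) := by ring
      rw [e1, e2, er, eN, hrh, div_mul_cancel₀ _ hdr0.ne']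
    exact mul_right_cancel₀ hd0.ne' h1
  -- ρ_h ≤ ρ₀ (< y): the middle copy is light for h; its discounted pool power p1 = (1 − G_h)/G_h
  have hrhρ : rh ≤ ρ₀ := by
    rw [hrh, hρ₀, div_le_div_iff₀ hdr0 (by linarith : (0:ℝ) < (h:ℝ) - l), hd, hN, hT₀, hT]
    have e : a * (S + q * ((r : ℝ) + k * g)) - 2 * (l : ℝ) - 2 * r = a * (S + q * ((r : ℝ) + k * g)) - 2 * ((l : ℝ) + r) := by ring
    rw [e]; exact hminus
  have hrhy : rh ≤ y := le_trans hrhρ hρ₀y.le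
  have hCpos : 0 < γ * (t2 + t1) := mul_pos hγ0 (by linarith [lt_of_lt_of_le hy0 hyt2])
  obtain ⟨Gh, hGh⟩ : ∃ Gh : ℝ, Gh = y ^ 2 + (1 - y) * rh := ⟨_, rfl⟩
  have hGhy : Gh ≤ y := by rw [hGh]; nlinarith [mul_le_mul_of_nonneg_left hrhy h1y.le]
  have hGh0 : 0 < Gh := by rw [hGh]; positivity
  have hGh1 : 0 < 1 - Gh := by linarith
  obtain ⟨p1, hp1⟩ : ∃ p1 : ℝ, p1 = (1 - Gh) / Gh := ⟨_, rfl⟩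
  have hp10 : 0 < p1 := by rw [hp1]; exact div_pos hGh1 hGh0
  have vlt : ((l + r : ℕ) : ℝ) < h := by rw [eLr]; linarith
  have hlight1' : T - 2 * ((l + r : ℕ) : ℝ) ≤ y * ((h : ℝ) - ((l + r : ℕ) : ℝ)) := by
    have h1 : N - 2 * (r : ℝ) ≤ y * (d - r) := by
      have := mul_le_mul_of_nonneg_right hrhy hdr0.le
      rw [hrh, div_mul_cancel₀ _ hdr0.ne'] at this; exact this
    rw [eLr, show (h : ℝ) - ((l : ℝ) + r) = d - r by rw [hd]; ring]; rw [hN] at h1; linarith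
  have vP1 : p1 * usage y T j (l + r) h ≤ 1 := by
    have e := GluedWindow.apow_light_exact_valid y T 1 j (l + r) h hy0 hy1 hhj hlowlr vlt hlight1'
    rw [erh, ← hGh, ← hp1, one_mul] at e
    exact e.le
  have core := diag_poolMinus y ρ₀ rh (1 - t1 - t2) t1 nu ee hy0 hy1 hrh0 hrhρ hρ₀y.le hnuy hrel ht0p ht1p (by linarith) hc12
  rw [← hγ, ← hGh, show 1 - (1 - t1 - t2) - t1 = t2 by ring] at core
  have hmain : ((1 - γ) * (1 - t1 - t2) - γ * (1 - t1 - t2) * ph) / pu + (1 - γ) * t1 / p1 ≤ γ * (t2 + t1) := by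
    have e1 : ((1 - γ) * (1 - t1 - t2) - γ * (1 - t1 - t2) * ph) / pu ≤ (1 - t1 - t2) * (1 - γ / nu) * (y / (1 - y)) := by
      rw [epu]; exact mul_le_mul_of_nonneg_right hL0' (div_nonneg hy0.le h1y.le)
    have e2 : (1 - γ) * t1 / p1 = t1 * (Gh - γ) / (1 - Gh) + γ * t1 := by rw [hp1]; field_simp; ring
    rw [e2]; linarith [e1, core]
  have vP1' : p1 * (y / (1 - y)) ≤ 1 ∨ (T < ((l : ℝ) + r) + h ∧ p1 * usage y T j (l + r) h ≤ 1) := Or.inr ⟨by rw [← eLr]; exact hcomp1, vP1⟩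
  -- shares of the pool (capacity units)
  obtain ⟨σ, hσ0, hσ1, hc0, hc1⟩ := diag_share (((1 - γ) * (1 - t1 - t2) - γ * (1 - t1 - t2) * ph) / pu) ((1 - γ) * t1 / p1)
    (γ * (t2 + t1)) hCpos (div_nonneg hL0 hpu0.le) (by
      have : 0 ≤ (1 - γ) * t1 / p1 := div_nonneg (mul_nonneg h1γ.le ht1p) hp10.le
      linarith [hmain]) hmain
  have hc0' : (1 - γ) * (1 - t1 - t2) - γ * (1 - t1 - t2) * ph ≤ σ * (γ * (t2 + 1 * t1) * pu) := by
    rw [div_le_iff₀ hpu0] at hc0; rw [one_mul]; linarith [hc0]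
  have hc1' : (1 - γ) * t1 ≤ (1 - σ) * (γ * (t2 + 1 * t1) * p1) := by
    rw [div_le_iff₀ hp10] at hc1; rw [one_mul]; linarith [hc1]
  have h1σ : 0 ≤ 1 - σ := by linarith
  refine gluedPullback_windowPair_twoRow_mid_of_assign x a q g S B r k j l h c ls α p 1 0 ph 0 pu 0 0 0 p1
    0 1 0 σ 0 0 0 (1 - σ)
    hx0 hx1 ha0 ha1 hq0 hq1 hg0 hg1 hr hlh hhB hwin hlow hcomp hL2j hL2mid hL1low hhmid (Or.inr ⟨hjr, rfl⟩) hhc hcB hcj hp hαp hcheap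
    le_rfl hph0 le_rfl hpu0.le le_rfl le_rfl le_rfl hp10.le le_rfl zero_le_one le_rfl hσ0 le_rfl le_rfl le_rfl h1σ
    (by linarith) (by linarith) (by linarith) (by linarith)
    ?_ (Or.inl rfl) ?_ ?_ ?_ (Or.inl rfl) (Or.inl ?_) ?_ (Or.inl rfl) ?_ (Or.inl rfl) ?_ (Or.inl rfl) ?_ ?_ ?_
  · rw [zero_mul]; exact zero_le_one
  · rw [← hy, ← hT]; exact vH
  · rw [← hT]; exact hcH
  · rw [zero_mul]; exact zero_le_one
  · rw [← hy]; exact vP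
  · rw [zero_mul]; exact zero_le_one
  · rw [zero_mul]; exact zero_le_one
  · rw [zero_mul]; exact zero_le_one
  · rw [← hy, ← hT]; exact vP1'
  · rw [hγ', ← ht1, ← ht2, ← et0]
    have e : 0 * ((1 - γ) * t2 * 0) + 1 * (γ * (1 - t1 - t2) * ph) + 0 * (γ * t1 * (1 - 1) * 0) + σ * (γ * (t2 + 1 * t1) * pu)
        = γ * (1 - t1 - t2) * ph + σ * (γ * (t2 + 1 * t1) * pu) := by ring
    rw [e]; linarith [hc0']
  · rw [hγ', ← ht1, ← ht2]
    have e : 0 * ((1 - γ) * t2 * 0) + 0 * (γ * (1 - q) * 0) + 0 * (γ * t1 * (1 - 1) * 0) + (1 - σ) * (γ * (t2 + 1 * t1) * p1)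
        = (1 - σ) * (γ * (t2 + 1 * t1) * p1) := by ring
    rw [e]; exact hc1'

/-- **TWO-ROW REGIME, h MID, TOP COPY UNREACHABLE, `h + r` A GIANT — ASSEMBLED**: `2l + r + k ≤ T`, `y(h−l) ≤ T−2l`, `T < l + r + h`, `j < h + r` ⟹
`(1−γ)Ψ(l) + γΨ(h) ≤ 0` for every price system and every cheap `c ≥ h`; no side condition (`…_giantG` ∪ `…_giantG_minus`). [this work] -/
theorem gluedPullback_windowPair_twoRow_noTop_giant (x a q g S : ℝ) (B r k j l h c ls : ℕ) (α p : ℕ → ℝ)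
    (hx0 : 0 < x) (hx1 : x < 1) (ha0 : 0 < a) (ha1 : a ≤ 1) (hq0 : 0 < q) (hq1 : q < 1) (hg0 : 0 ≤ g) (hg1 : g ≤ 1) (hr : 1 ≤ r)
    (hxqg : x ≤ q * g)
    (hlh : l < h) (hhB : h ≤ B) (hhj : h ≤ j) (hwin : j < h + r + k) (hlow : 2 * (l : ℝ) < a * S) (hcomp : a * S < (l : ℝ) + h)
    (hlight : pairGate (a * x) (a * S) l h < a * x)
    (hL2j : l + r + k ≤ j) (hL2mid : a * (S + q * ((r : ℝ) + k * g)) ≤ 2 * ((l : ℝ) + r + k))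
    (hL1low : 2 * ((l : ℝ) + r) < a * (S + q * ((r : ℝ) + k * g))) (hhmid : a * (S + q * ((r : ℝ) + k * g)) ≤ 2 * (h : ℝ))
    (hincl : 2 * (l : ℝ) + r + k ≤ a * (S + q * ((r : ℝ) + k * g)))
    (hheavyT : (a * x) * ((h : ℝ) - l) ≤ a * (S + q * ((r : ℝ) + k * g)) - 2 * (l : ℝ))
    (hcompat1 : a * (S + q * ((r : ℝ) + k * g)) < (l : ℝ) + r + h) (hjr : j < h + r)
    (hhc : h ≤ c) (hcB : c ≤ B) (hcj : c ≤ j)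
    (hp : ∀ h, 0 ≤ p h)
    (hαp : ∀ l' h', l' ≤ j → 2 * (l' : ℝ) < a * (S + q * ((r : ℝ) + k * g)) → h' ≤ B + (r + k) →
      (j + 1 ≤ h' ∨ a * (S + q * ((r : ℝ) + k * g)) < (l' : ℝ) + h') →
      α l' ≤ usage (a * x) (a * (S + q * ((r : ℝ) + k * g))) j l' h' * p h')
    (hcheap : -(gluedPullback (a * (S + q * ((r : ℝ) + k * g))) q g j r k α p c) * (a * x)
      < (1 - a * x) * gluedPullback (a * (S + q * ((r : ℝ) + k * g))) q g j r k α p ls) :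
    (1 - pairGate (a * x) (a * S) l h) * gluedPullback (a * (S + q * ((r : ℝ) + k * g))) q g j r k α p l
      + pairGate (a * x) (a * S) l h * gluedPullback (a * (S + q * ((r : ℝ) + k * g))) q g j r k α p h ≤ 0 := by
  by_cases hm : (a * (S + q * ((r : ℝ) + k * g)) - 2 * ((l : ℝ) + r)) * ((h : ℝ) - l) ≤ (a * S - 2 * (l : ℝ)) * ((h : ℝ) - l - r)
  · exact gluedPullback_windowPair_twoRow_noTop_giantG_minus x a q g S B r k j l h c ls α p hx0 hx1 ha0 ha1 hq0 hq1 hg0 hg1 hr hxqg hlh hhB hhj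
      hwin hlow hcomp hlight hL2j hL2mid hL1low hhmid hincl hheavyT hcompat1 hjr hm hhc hcB hcj hp hαp hcheap
  · exact gluedPullback_windowPair_twoRow_noTop_giantG x a q g S B r k j l h c ls α p hx0 hx1 ha0 ha1 hq0 hq1 hg0 hg1 hr hxqg hlh hhB hhj
      hwin hlow hcomp hlight hL2j hL2mid hL1low hhmid hincl hheavyT hcompat1 hjr (Or.inr (lt_of_not_ge hm).le) hhc hcB hcj hp hαp hcheap

end LawDec
end Quant
end Summit.CriticalPhenomena.PercolationContinuityZ3.Theorems
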